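import Mathlib
import Literature.NumberTheory.Sieve.HybridLargeSieve
import HarnessLib

/-!
# Gallagher's weighted mean value theorem for Dirichlet polynomials (Gallagher 1970, Theorem 1)

Topic `Literature/NumberTheory/Sieve`, sub-namespace `LargeSieve`. Everything here is PROVED.

P. X. Gallagher, *A large sieve density estimate near `σ = 1`*, Invent. Math. 11 (1970) 329–339,
Theorem 1: for `T ≥ 1` and complex `a_n` with `∑ n|a_n|² < ∞`,
`∫_{−T}^{T} |∑_n a_n n^{it}|² dt ≪ ∑_n (T + n)|a_n|²` — the WEIGHTED form of the mean value theorem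
for Dirichlet polynomials (sharper than `(T + N)∑|a_n|²` for decaying coefficients; the tree's
`Literature.NumberTheory.LFunctions.dirichletPolynomial_meanSquare_le` is the unweighted
`(5T + 18N)∑|a_n|²`, and `hybridSieve_character` in `HybridLargeSieve.lean` is the version with
characters). Here, for a finite set `S` of positive integers, with explicit constants:

* `window_bound_trivial` — one logarithmic window by Cauchy–Schwarz:
  `|T ∑_{x ≤ ν_n ≤ x+δ} b_n|² ≤ ∑_n |b_n|² T²((e^{2πδ} − 1)n + 1) 𝟙_{[ν_n−δ,ν_n]}(x)`;
* `hybridMeanValue` — `∫_{−T}^{T} |∑_{n ∈ S} b_n e(ν_n t)|² dt ≤ π² ∑_{n ∈ S} ((π e^π/2) n + T/2)|b_n|²`;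
* `hybridMeanValue_cpow` — in the notation `n^{it}`:
  `∫_{−T}^{T} |∑_{n ∈ S} b_n n^{it}|² dt ≤ (π³e^π/2) ∑_{n ∈ S} (n + T)|b_n|²`.

Proof: Gallagher's Lemma 1 (`Literature.NumberTheory.Sieve.Gallagher.gallagher_lemma_general`)
with `ν_n = (log n)/2π`, `δ = 1/(2T)`; a window `x ≤ ν_n ≤ x + δ` holds at most
`(e^{2πδ} − 1)e^{2πx} + 1 ≤ (e^{2πδ} − 1)n + 1` integers (`logWindow_length_le`), Cauchy–Schwarz,
and `(T/2)(e^{π/T} − 1) ≤ π e^π/2`.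

## References
* [Gallagher1970] Theorem 1.
* [Montgomery1971] Ch. 6 (mean value theorems for Dirichlet polynomials).
-/

noncomputable section

open Finset Real Complex MeasureTheory
open scoped ComplexConjugate FourierTransform

namespace Literature.NumberTheory.Sieve.LargeSieve

open Literature.NumberTheory.Sieve.Gallagher Literature.NumberTheory.Sieve.MontgomeryVaughan1975

/-! ### One window by Cauchy–Schwarz -/

/-- Numerical fact about the constant: `2 ≤ π e^π/2`. [folklore] -/
private theorem two_le_pi_mul_exp_pi_div_two' : (2 : ℝ) ≤ π * Real.exp π / 2 := by
  have hπ : (3 : ℝ) ≤ π := by linarith [Real.pi_gt_three]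
  have he : (1 : ℝ) + π ≤ Real.exp π := by linarith [Real.add_one_le_exp π]
  nlinarith [Real.exp_pos π]

/-- Cauchy–Schwarz on a finite set: `|∑_{i ∈ W} c_i|² ≤ |W| ∑_{i ∈ W} |c_i|²`. [folklore] -/
private theorem norm_sq_sum_le_card_mul (W : Finset ℕ) (c : ℕ → ℂ) :
    ‖∑ i ∈ W, c i‖ ^ 2 ≤ (W.card : ℝ) * ∑ i ∈ W, ‖c i‖ ^ 2 := by
  have h1 : ‖∑ i ∈ W, c i‖ ≤ ∑ i ∈ W, ‖c i‖ := norm_sum_le _ _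
  have h2 : (∑ i ∈ W, ‖c i‖) ^ 2 ≤ (W.card : ℝ) * ∑ i ∈ W, ‖c i‖ ^ 2 := by
    have h := Finset.sum_mul_sq_le_sq_mul_sq W (fun _ => (1 : ℝ)) (fun i => ‖c i‖)
    simp only [one_mul, one_pow, sum_const, nsmul_eq_mul, mul_one] at h
    exact h
  exact (pow_le_pow_left₀ (norm_nonneg _) h1 2).trans h2

/-- **One window, no characters** (the step of Gallagher's proof):
`|T ∑_{x ≤ ν_n ≤ x+δ} b_n|² ≤ ∑_n |b_n|² T²((e^{2πδ}−1)n + 1) 𝟙_{[ν_n−δ,ν_n]}(x)`.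
[cite: Gallagher1970, Thm 1 (proof)] -/
theorem window_bound_trivial (S : Finset ℕ) (hS : ∀ n ∈ S, 1 ≤ n) (b : ℕ → ℂ) {T δ : ℝ}
    (hδ : 0 < δ) (x : ℝ) :
    ‖(T : ℂ) * ∑ n ∈ S.filter (fun n => x ≤ logFreq n ∧ logFreq n ≤ x + δ), b n‖ ^ 2 ≤
      ∑ n ∈ S, ‖b n‖ ^ 2 * (T ^ 2 * ((Real.exp (2 * π * δ) - 1) * n + 1)) *
        (Set.Icc (logFreq n - δ) (logFreq n)).indicator (fun _ => (1 : ℝ)) x := by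
  set Wx : Finset ℕ := S.filter (fun n => x ≤ logFreq n ∧ logFreq n ≤ x + δ) with hWx
  set M₀ : ℕ := ⌈Real.exp (2 * π * x)⌉₊ - 1 with hM₀
  set N : ℕ := ⌊Real.exp (2 * π * (x + δ))⌋₊ + 1 - ⌈Real.exp (2 * π * x)⌉₊ with hN
  have hWin : ∀ n ∈ Wx, M₀ < n ∧ n ≤ M₀ + N := by
    intro n hn
    rw [hWx, mem_filter] at hn
    exact mem_logWindow_bounds (hS n hn.1) hn.2
  have hsub : Wx ⊆ Ioc M₀ (M₀ + N) := fun n hn => by rw [mem_Ioc]; exact hWin n hn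
  have hcard : (Wx.card : ℝ) ≤ N := by
    have := card_le_card hsub
    rw [Nat.card_Ioc] at this
    exact_mod_cast (by omega : Wx.card ≤ N)
  have hNle : (N : ℝ) ≤ (Real.exp (2 * π * δ) - 1) * Real.exp (2 * π * x) + 1 :=
    logWindow_length_le x hδ
  have hexpδ : 0 ≤ Real.exp (2 * π * δ) - 1 := by
    linarith [Real.exp_le_exp.2 (show (0:ℝ) ≤ 2 * π * δ by positivity), Real.exp_zero]
  have hCS := norm_sq_sum_le_card_mul Wx b
  rw [norm_mul, mul_pow, Complex.norm_real, Real.norm_eq_abs, sq_abs]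
  have hterm : ∀ n ∈ Wx, T ^ 2 * ((Wx.card : ℝ) * ‖b n‖ ^ 2) ≤
      ‖b n‖ ^ 2 * (T ^ 2 * ((Real.exp (2 * π * δ) - 1) * n + 1)) := by
    intro n hn
    have hn' := hn
    rw [hWx, mem_filter] at hn'
    obtain ⟨h1, -⟩ := exp_le_of_logFreq_window (hS n hn'.1) hn'.2
    have hN2 : (Wx.card : ℝ) ≤ (Real.exp (2 * π * δ) - 1) * n + 1 := by
      nlinarith [mul_le_mul_of_nonneg_left h1 hexpδ]
    have hb : 0 ≤ ‖b n‖ ^ 2 := by positivity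
    calc T ^ 2 * ((Wx.card : ℝ) * ‖b n‖ ^ 2) = ‖b n‖ ^ 2 * (T ^ 2 * (Wx.card : ℝ)) := by ring
      _ ≤ ‖b n‖ ^ 2 * (T ^ 2 * ((Real.exp (2 * π * δ) - 1) * n + 1)) :=
          mul_le_mul_of_nonneg_left (mul_le_mul_of_nonneg_left hN2 (sq_nonneg T)) hb
  calc T ^ 2 * ‖∑ n ∈ Wx, b n‖ ^ 2 ≤ T ^ 2 * ((Wx.card : ℝ) * ∑ n ∈ Wx, ‖b n‖ ^ 2) :=
        mul_le_mul_of_nonneg_left hCS (sq_nonneg T)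
    _ = ∑ n ∈ Wx, T ^ 2 * ((Wx.card : ℝ) * ‖b n‖ ^ 2) := by rw [mul_sum, mul_sum]
    _ ≤ ∑ n ∈ Wx, ‖b n‖ ^ 2 * (T ^ 2 * ((Real.exp (2 * π * δ) - 1) * n + 1)) := sum_le_sum hterm
    _ ≤ _ := by
        rw [hWx, sum_filter]
        refine sum_le_sum fun n _ => ?_
        by_cases hw : x ≤ logFreq n ∧ logFreq n ≤ x + δ
        · rw [if_pos hw, Set.indicator_of_mem (by
            rw [Set.mem_Icc]; constructor <;> linarith [hw.1, hw.2]), mul_one]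
        · rw [if_neg hw, Set.indicator_of_notMem (by
            rw [Set.mem_Icc]; intro h'; exact hw ⟨h'.2, by linarith [h'.1]⟩), mul_zero]

/-- **The weighted mean value theorem for Dirichlet polynomials** (Gallagher 1970, Theorem 1, in
the form `∫_{−T}^{T}|∑ a_n n^{it}|² dt ≪ ∑ (T + n)|a_n|²`), with an explicit constant: for `T ≥ 1`, a
finite set `S` of positive integers and complex `b_n`,
`∫_{−T}^{T} |∑_{n ∈ S} b_n e(ν_n t)|² dt ≤ π² ∑_{n ∈ S} ((π e^π/2) n + T/2)|b_n|²`.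
[cite: Gallagher1970, Thm 1] -/
theorem hybridMeanValue {T : ℝ} (hT : 1 ≤ T) (S : Finset ℕ) (hS : ∀ n ∈ S, 1 ≤ n) (b : ℕ → ℂ) :
    ∫ t in (-T)..T, ‖∑ n ∈ S, b n * (𝐞 (logFreq n * t) : ℂ)‖ ^ 2 ≤
      π ^ 2 * ∑ n ∈ S, (π * Real.exp π / 2 * n + T / 2) * ‖b n‖ ^ 2 := by
  have hT0 : 0 < T := by linarith
  set δ : ℝ := (2 * T)⁻¹ with hδ
  have hδ0 : 0 < δ := by rw [hδ]; positivity
  set K : ℕ → ℝ := fun n => T ^ 2 * ((Real.exp (2 * π * δ) - 1) * n + 1) with hK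
  -- Gallagher's lemma
  have hG : ∫ t in (-T)..T, ‖∑ n ∈ S, b n * (𝐞 (logFreq n * t) : ℂ)‖ ^ 2 ≤
      π ^ 2 * ∫ x : ℝ, ‖(T : ℂ) * ∑ n ∈ S.filter (fun n => x ≤ logFreq n ∧ logFreq n ≤ x + δ),
        b n‖ ^ 2 := by
    have h := gallagher_lemma_general S logFreq b hT0
    rw [← hδ] at h
    exact h
  have hint : Integrable fun x : ℝ =>
      ‖(T : ℂ) * ∑ n ∈ S.filter (fun n => x ≤ logFreq n ∧ logFreq n ≤ x + δ), b n‖ ^ 2 :=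
    integrable_normSq_windowSum S logFreq b T δ
  have hRint : Integrable fun x : ℝ => ∑ n ∈ S, ‖b n‖ ^ 2 * K n *
      (Set.Icc (logFreq n - δ) (logFreq n)).indicator (fun _ => (1 : ℝ)) x := by
    refine integrable_finsetSum _ fun n _ => ?_
    refine Integrable.const_mul ?_ _
    rw [integrable_indicator_iff measurableSet_Icc]
    exact integrableOn_const (by exact measure_Icc_lt_top.ne)
  have hstep3 : ∫ x : ℝ, ‖(T : ℂ) * ∑ n ∈ S.filter (fun n => x ≤ logFreq n ∧ logFreq n ≤ x + δ),
        b n‖ ^ 2 ≤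
      ∫ x : ℝ, ∑ n ∈ S, ‖b n‖ ^ 2 * K n *
        (Set.Icc (logFreq n - δ) (logFreq n)).indicator (fun _ => (1 : ℝ)) x :=
    integral_mono hint hRint fun x => window_bound_trivial S hS b hδ0 x
  have hstep4 : ∫ x : ℝ, ∑ n ∈ S, ‖b n‖ ^ 2 * K n *
      (Set.Icc (logFreq n - δ) (logFreq n)).indicator (fun _ => (1 : ℝ)) x =
      ∑ n ∈ S, ‖b n‖ ^ 2 * K n * δ := by
    rw [integral_finsetSum _ fun n _ => ?_]
    · exact sum_congr rfl fun n _ => integral_const_mul_indicator_Icc _ _ hδ0.le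
    · refine Integrable.const_mul ?_ _
      rw [integrable_indicator_iff measurableSet_Icc]
      exact integrableOn_const (by exact measure_Icc_lt_top.ne)
  have hexpδ : (Real.exp (2 * π * δ) - 1) * T ≤ π * Real.exp π := by
    rw [hδ]; exact exp_two_pi_delta_sub_one_mul_le hT
  have hKδ : ∀ n ∈ S, ‖b n‖ ^ 2 * K n * δ ≤ (π * Real.exp π / 2 * n + T / 2) * ‖b n‖ ^ 2 := by
    intro n _
    have hn0 : (0 : ℝ) ≤ n := Nat.cast_nonneg n
    have hTδ : T ^ 2 * δ = T / 2 := by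
      rw [hδ]; field_simp
    have hmain : K n * δ ≤ π * Real.exp π / 2 * n + T / 2 := by
      rw [hK]; dsimp only
      have hA : (T ^ 2 * δ) * ((Real.exp (2 * π * δ) - 1) * n) ≤ π * Real.exp π / 2 * n := by
        rw [hTδ]
        have := mul_le_mul_of_nonneg_right hexpδ hn0
        nlinarith
      calc T ^ 2 * ((Real.exp (2 * π * δ) - 1) * n + 1) * δ
          = (T ^ 2 * δ) * ((Real.exp (2 * π * δ) - 1) * n) + T ^ 2 * δ := by ring
        _ ≤ π * Real.exp π / 2 * n + T / 2 := add_le_add hA hTδ.le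
    have hb : 0 ≤ ‖b n‖ ^ 2 := by positivity
    calc ‖b n‖ ^ 2 * K n * δ = ‖b n‖ ^ 2 * (K n * δ) := by ring
      _ ≤ ‖b n‖ ^ 2 * (π * Real.exp π / 2 * n + T / 2) := mul_le_mul_of_nonneg_left hmain hb
      _ = _ := by ring
  calc _ ≤ π ^ 2 * ∫ x : ℝ, ‖(T : ℂ) * ∑ n ∈ S.filter (fun n => x ≤ logFreq n ∧ logFreq n ≤ x + δ),
        b n‖ ^ 2 := hG
    _ ≤ π ^ 2 * ∑ n ∈ S, ‖b n‖ ^ 2 * K n * δ := by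
        rw [← hstep4]; exact mul_le_mul_of_nonneg_left hstep3 (by positivity)
    _ ≤ _ := mul_le_mul_of_nonneg_left (sum_le_sum hKδ) (by positivity)

/-- **The weighted mean value theorem in the notation `n^{it}`**: for `T ≥ 1`,
`∫_{−T}^{T} |∑_{n ∈ S} b_n n^{it}|² dt ≤ (π³e^π/2) ∑_{n ∈ S} (n + T)|b_n|²`.
[cite: Gallagher1970, Thm 1] -/
theorem hybridMeanValue_cpow {T : ℝ} (hT : 1 ≤ T) (S : Finset ℕ) (hS : ∀ n ∈ S, 1 ≤ n)
    (b : ℕ → ℂ) :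
    ∫ t in (-T)..T, ‖∑ n ∈ S, b n * (n : ℂ) ^ ((t : ℂ) * I)‖ ^ 2 ≤
      (π ^ 3 * Real.exp π / 2) * ∑ n ∈ S, ((n : ℝ) + T) * ‖b n‖ ^ 2 := by
  have heq : ∀ t : ℝ, ∑ n ∈ S, b n * (n : ℂ) ^ ((t : ℂ) * I) =
      ∑ n ∈ S, b n * (𝐞 (logFreq n * t) : ℂ) := fun t =>
    sum_congr rfl fun n hn => by rw [natCast_cpow_mul_I n (hS n hn) t]
  simp only [heq]
  refine (hybridMeanValue hT S hS b).trans ?_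
  have hT0 : 0 ≤ T := by linarith
  have hc := two_le_pi_mul_exp_pi_div_two'
  have hterm : ∀ n ∈ S, (π * Real.exp π / 2 * n + T / 2) * ‖b n‖ ^ 2 ≤
      (π * Real.exp π / 2) * (((n : ℝ) + T) * ‖b n‖ ^ 2) := by
    intro n _
    have hb : 0 ≤ ‖b n‖ ^ 2 := by positivity
    have h1 : T / 2 ≤ (π * Real.exp π / 2) * T := by nlinarith
    calc (π * Real.exp π / 2 * n + T / 2) * ‖b n‖ ^ 2
        ≤ (π * Real.exp π / 2 * n + (π * Real.exp π / 2) * T) * ‖b n‖ ^ 2 :=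
          mul_le_mul_of_nonneg_right (add_le_add le_rfl h1) hb
      _ = _ := by ring
  calc π ^ 2 * ∑ n ∈ S, (π * Real.exp π / 2 * n + T / 2) * ‖b n‖ ^ 2
      ≤ π ^ 2 * ∑ n ∈ S, (π * Real.exp π / 2) * (((n : ℝ) + T) * ‖b n‖ ^ 2) :=
        mul_le_mul_of_nonneg_left (sum_le_sum hterm) (by positivity)
    _ = (π ^ 3 * Real.exp π / 2) * ∑ n ∈ S, ((n : ℝ) + T) * ‖b n‖ ^ 2 := by
        rw [← mul_sum]; ring

end Literature.NumberTheory.Sieve.LargeSieve
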